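import Literature.AlgebraicGeometry.HyperbolicPolynomials.HyperbolicityConeComponent
import Literature.AlgebraicGeometry.HyperbolicPolynomials.MinEigenvalue
import HarnessLib

/-!
# The lineality space of a hyperbolic polynomial and of its hyperbolicity cone (Güler 1997, Theorem 3.2)

Topic `Literature/AlgebraicGeometry/HyperbolicPolynomials`, namespace
`Literature.AlgebraicGeometry.HyperbolicPolynomials`; a companion of `HyperbolicityCone.lean` (`IsHyperbolic`,
`openHyperbolicityCone` = Renegar's `Λ₊₊` = Güler's `K(p; d)`, `hyperbolicityCone` = `Λ₊`, `eigenvalues`),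
`Garding.lean` (Gårding's theorem `IsHyperbolic.of_mem_openHyperbolicityCone`, `openHyperbolicityCone_eq_of_mem`),
`HyperbolicityConeComponent.lean` (`mem_openHyperbolicityCone_of_segment_subset`) and `MinEigenvalue.lean`
(`mem_eigenvalues_neg_iff`); lane `lit-hodgefound`
(Track 2 foundations library), seat p16, generation 31 (row g31-#11). As everywhere in this directory,
hyperbolic *forms* are meant (`f.IsHomogeneous d` explicit).

## Source (verbatim) — O. Güler, *Hyperbolic polynomials and interior point methods for convex programming*,
## Math. Oper. Res. 22 (1997) 350–377 [Guler1997] (held: `paper:doi-10-1287-moor-22-2-350`, pp. 11–12)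

"The cone `K(p; d)` is open and convex, but it may contain entire lines. Thus, it is of interest to
characterize when `K(p; d)` is a regular cone." **Definition 3.1.** "Let `p ∈ Hyp(d; m)`. The lineality space of
the cone `K = K(p; d)` is `L(K) = {x ∈ ℝⁿ : K + x = K}`, and the lineality space of `p` is
`L(p) = {x ∈ ℝⁿ : p(y + tx) = p(y), t ∈ ℝ, y ∈ ℝⁿ}`." **Theorem 3.2.** "We have `L(p) = L(K(p; d))`."
**Definition 3.2.** "A polynomial `p ∈ Hyp(d; m)` is called complete if `L(p) = L(K(p; d)) = {0}`." Proof of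
Theorem 3.2 (sketch as printed): for `x ∈ L(p)` and `y, z ∈ K`, `p(tx + y + sz) = p(y + sz)` has the roots
`s_k(z; y) < 0`, so `tx + y ∈ K`; conversely for `x ∈ L(K)`, `tx + y ∈ K` for all `t`, "letting `t → ∞`" all
`s_k(z; x) = 0`, hence `p(x + sz) = sᵐ p(z)`, "`p(tx + z) = p(z)` for `z ∈ K`", and "since `K` is open, the
above equation [holds] for all `z ∈ ℝⁿ`".

## What is here

* §1 `linealitySpace f` (`L(p)`), `setLinealitySpace K` (`L(K) = {x : x + K = K}`) and their unfoldings;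
  `L(p)` is closed under negation and scaling; `IsCompleteHyperbolic f` (Definition 3.2: `L(p) = {0}`).
* §2 **`linealitySpace_subset_setLinealitySpace`** — `L(p) ⊆ L(K(p; e))` (segments `[y, y + x]` stay in
  `{p ≠ 0}`, so `y + x` lies in the component `K` of `y`).
* §3 `setLinealitySpace_smul_mem` (`L(K)` is closed under scaling, `K` being a convex cone);
  `mem_hyperbolicityCone_of_mem_setLinealitySpace` (`L(K) ⊆ Λ₊ ∩ −Λ₊`); `eigenvalues_eq_zero_of_mem_setLinealitySpace`
  (all eigenvalues of `x ∈ L(K)` vanish) and `eval_add_smul_of_mem_setLinealitySpace` (`p(x + te) = tᵐ p(e)`);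
  `exists_forall_le_add_smul_mem` (`y + se ∈ K` for all large `s`); **`setLinealitySpace_subset_linealitySpace`**
  — `L(K) ⊆ L(p)`; and **`linealitySpace_eq`** — Theorem 3.2.

## Proof route and the deviations

`L(p) ⊆ L(K)`: as printed, with `K` = the connected component of `{p ≠ 0}` (tree
`mem_openHyperbolicityCone_of_segment_subset`). `L(K) ⊆ L(p)`: instead of "letting `t → ∞`" in the eigenvalues
(continuity of roots), `x ∈ L(K)` gives `e + x/τ ∈ K`, i.e. `x + τe ∈ K` for all `τ > 0`, which is `x ∈ Λ₊` by
the root-free definition of the closed cone; the same for `−x`; so all eigenvalues of `x` are `≥ 0` and `≤ 0`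
(`mem_eigenvalues_neg_iff`), and `p(x + te) = p(e) ∏(t + λᵢ(x)) = tᵐ p(e)`. By Gårding's theorem this holds
with `e` replaced by any `e' ∈ K` (`K(p; e') = K(p; e)`), giving `p(x + e') = p(e')` on `K`; instead of the
openness of `K`, the univariate polynomial `s ↦ p(y + x + se) − p(y + se)` vanishes for all large `s`
(`y + se ∈ K`), hence identically, hence at `s = 0`.

## References

* [Guler1997] O. Güler, *Hyperbolic polynomials and interior point methods for convex programming*, Math. Oper.
  Res. 22 (1997) 350–377 — §3, Definition 3.1, Theorem 3.2, Definition 3.2.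
* [Renegar2006] J. Renegar, *Hyperbolic programs, and their derivative relaxations*, Found. Comput. Math. 6
  (2006) — §2 (the cones `Λ₊₊`, `Λ₊`, eigenvalues; vocabulary of `HyperbolicityCone.lean`).
* [Garding1959] L. Gårding, *An inequality for hyperbolic polynomials*, J. Math. Mech. 8 (1959) — Thm. 2
  (hyperbolicity with respect to every point of the cone).
-/

noncomputable section

open MvPolynomial
open scoped Pointwise

namespace Literature.AlgebraicGeometry.HyperbolicPolynomials

variable {σ : Type*}

/-! ## §1 The two lineality spaces (Definition 3.1) and completeness (Definition 3.2) -/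

/-- **The lineality space of a polynomial** (Güler 1997, Definition 3.1):
`L(p) = {x ∈ ℝⁿ : p(y + tx) = p(y) for all t ∈ ℝ, y ∈ ℝⁿ}`. [cite: Guler1997, §3 Definition 3.1] -/
def linealitySpace (f : MvPolynomial σ ℝ) : Set (σ → ℝ) :=
  {x | ∀ (y : σ → ℝ) (t : ℝ), MvPolynomial.eval (y + t • x) f = MvPolynomial.eval y f}

/-- **The lineality space of a cone** (Güler 1997, Definition 3.1): `L(K) = {x ∈ ℝⁿ : K + x = K}` (for any
subset `K ⊆ ℝⁿ`). [cite: Guler1997, §3 Definition 3.1] -/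
def setLinealitySpace (K : Set (σ → ℝ)) : Set (σ → ℝ) :=
  {x | x +ᵥ K = K}

/-- Unfolding `linealitySpace`. [cite: Guler1997, §3 Definition 3.1] -/
theorem mem_linealitySpace_iff (f : MvPolynomial σ ℝ) (x : σ → ℝ) :
    x ∈ linealitySpace f ↔ ∀ (y : σ → ℝ) (t : ℝ), MvPolynomial.eval (y + t • x) f = MvPolynomial.eval y f :=
  Iff.rfl

/-- Unfolding `setLinealitySpace`: `K + x = K` iff `z − x ∈ K ↔ z ∈ K` for every `z`.
[cite: Guler1997, §3 Definition 3.1] -/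
theorem mem_setLinealitySpace_iff (K : Set (σ → ℝ)) (x : σ → ℝ) :
    x ∈ setLinealitySpace K ↔ ∀ z : σ → ℝ, z - x ∈ K ↔ z ∈ K := by
  have hmem : ∀ z : σ → ℝ, z ∈ x +ᵥ K ↔ z - x ∈ K := fun z => by
    rw [Set.mem_vadd_set]
    constructor
    · rintro ⟨k, hk, rfl⟩
      simpa [vadd_eq_add] using hk
    · intro h
      exact ⟨z - x, h, by simp [vadd_eq_add]⟩
  simp only [setLinealitySpace, Set.mem_setOf_eq, Set.ext_iff, hmem]

/-- `0 ∈ L(p)`. [cite: Guler1997, §3 Definition 3.1] -/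
theorem zero_mem_linealitySpace (f : MvPolynomial σ ℝ) : (0 : σ → ℝ) ∈ linealitySpace f :=
  fun y t => by rw [smul_zero, add_zero]

/-- `L(p)` is closed under scaling. [cite: Guler1997, §3 Definition 3.1] -/
theorem smul_mem_linealitySpace {f : MvPolynomial σ ℝ} {x : σ → ℝ} (hx : x ∈ linealitySpace f) (c : ℝ) :
    c • x ∈ linealitySpace f := fun y t => by
  rw [smul_smul]
  exact hx y (t * c)

/-- `L(p)` is closed under negation. [cite: Guler1997, §3 Definition 3.1] -/
theorem neg_mem_linealitySpace {f : MvPolynomial σ ℝ} {x : σ → ℝ} (hx : x ∈ linealitySpace f) :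
    -x ∈ linealitySpace f := by
  simpa using smul_mem_linealitySpace hx (-1)

/-- `0 ∈ L(K)`. [cite: Guler1997, §3 Definition 3.1] -/
theorem zero_mem_setLinealitySpace (K : Set (σ → ℝ)) : (0 : σ → ℝ) ∈ setLinealitySpace K := by
  rw [mem_setLinealitySpace_iff]
  intro z
  rw [sub_zero]

/-- **Complete hyperbolic polynomial** (Güler 1997, Definition 3.2): `L(p) = {0}` ("Thus, `p` is a complete
polynomial if and only if `K(p; d)` is a regular cone. Intuitively, this means that `p` depends on all
variables.") [cite: Guler1997, §3 Definition 3.2] -/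
def IsCompleteHyperbolic (f : MvPolynomial σ ℝ) : Prop :=
  linealitySpace f = {0}

/-- Unfolding `IsCompleteHyperbolic`: the only `x` with `p(y + tx) ≡ p(y)` is `x = 0`. [cite: Guler1997, §3 Definition 3.2] -/
theorem isCompleteHyperbolic_iff (f : MvPolynomial σ ℝ) :
    IsCompleteHyperbolic f ↔ ∀ x : σ → ℝ, x ∈ linealitySpace f → x = 0 := by
  rw [IsCompleteHyperbolic, Set.eq_singleton_iff_unique_mem]
  exact ⟨fun h => h.2, fun h => ⟨zero_mem_linealitySpace f, h⟩⟩

variable {f : MvPolynomial σ ℝ} {d : ℕ} {e : σ → ℝ}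

/-! ## §2 `L(p) ⊆ L(K(p; e))` -/

/-- Translating a point of `K` by a vector of `L(p)` stays in `K`: `p` is constant, hence nonzero, on the
segment `[y, y + x]`, so `y + x` lies in the component `K` of `y`. [cite: Guler1997, §3 Theorem 3.2 (proof,
first inclusion)] -/
theorem add_mem_openHyperbolicityCone_of_mem_linealitySpace (hf : f.IsHomogeneous d) (he : IsHyperbolic f e)
    {x y : σ → ℝ} (hx : x ∈ linealitySpace f) (hy : y ∈ openHyperbolicityCone f e) :
    y + x ∈ openHyperbolicityCone f e := by
  refine mem_openHyperbolicityCone_of_segment_subset hf he hy fun w hw => ?_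
  obtain ⟨a, b, -, -, hab, rfl⟩ := hw
  have hw' : a • y + b • (y + x) = y + b • x := by
    rw [smul_add, ← add_assoc, ← add_smul, hab, one_smul]
  rw [Set.mem_setOf_eq, hw', hx y b]
  exact eval_ne_zero_of_mem_openHyperbolicityCone hy

/-- **Theorem 3.2, first inclusion**: `L(p) ⊆ L(K(p; e))`. [cite: Guler1997, §3 Theorem 3.2] -/
theorem linealitySpace_subset_setLinealitySpace (hf : f.IsHomogeneous d) (he : IsHyperbolic f e) :
    linealitySpace f ⊆ setLinealitySpace (openHyperbolicityCone f e) := by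
  intro x hx
  rw [mem_setLinealitySpace_iff]
  intro z
  constructor
  · intro h
    have := add_mem_openHyperbolicityCone_of_mem_linealitySpace hf he hx h
    rwa [sub_add_cancel] at this
  · intro h
    have := add_mem_openHyperbolicityCone_of_mem_linealitySpace hf he (neg_mem_linealitySpace hx) h
    rwa [← sub_eq_add_neg] at this

/-! ## §3 `L(K(p; e)) ⊆ L(p)` -/

/-- Positive scaling inside `K`: `c • w ∈ K ↔ w ∈ K` for `c > 0`. [cite: Renegar2006, §2 ("if `x ∈ Λ₊₊`, then
`tx ∈ Λ₊₊` for all `t > 0`")] -/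
theorem smul_mem_openHyperbolicityCone_iff (hf : f.IsHomogeneous d) {w : σ → ℝ} {c : ℝ} (hc : 0 < c) :
    c • w ∈ openHyperbolicityCone f e ↔ w ∈ openHyperbolicityCone f e := by
  refine ⟨fun h => ?_, fun h => smul_mem_openHyperbolicityCone hf h hc⟩
  have := smul_mem_openHyperbolicityCone hf h (inv_pos.2 hc)
  rwa [smul_smul, inv_mul_cancel₀ hc.ne', one_smul] at this

/-- `L(K)` is closed under scaling (`K` is a cone: `K + tx = t(K + x) = K` for `t > 0`, and `K + x = K` iff
`K − x = K`). [cite: Guler1997, §3 Theorem 3.2 (proof: "`tx + y ∈ K`" for all real `t`)] -/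
theorem setLinealitySpace_smul_mem (hf : f.IsHomogeneous d) {x : σ → ℝ}
    (hx : x ∈ setLinealitySpace (openHyperbolicityCone f e)) (t : ℝ) :
    t • x ∈ setLinealitySpace (openHyperbolicityCone f e) := by
  rw [mem_setLinealitySpace_iff] at hx ⊢
  have hx' : ∀ z : σ → ℝ, z + x ∈ openHyperbolicityCone f e ↔ z ∈ openHyperbolicityCone f e := fun z => by
    have := hx (z + x)
    rw [add_sub_cancel_right] at this
    exact this.symm
  intro z
  rcases lt_trichotomy t 0 with ht | rfl | ht
  · have hs : 0 < -t := neg_pos.2 ht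
    have hz : z - t • x = (-t) • ((-t)⁻¹ • z + x) := by
      rw [smul_add, smul_smul, mul_inv_cancel₀ hs.ne', one_smul, neg_smul, sub_eq_add_neg]
    rw [hz, smul_mem_openHyperbolicityCone_iff hf hs, hx', ← smul_mem_openHyperbolicityCone_iff hf hs (w := (-t)⁻¹ • z),
      smul_smul, mul_inv_cancel₀ hs.ne', one_smul]
  · rw [zero_smul, sub_zero]
  · have hz : z - t • x = t • (t⁻¹ • z - x) := by
      rw [smul_sub, smul_smul, mul_inv_cancel₀ ht.ne', one_smul]
    rw [hz, smul_mem_openHyperbolicityCone_iff hf ht, hx, ← smul_mem_openHyperbolicityCone_iff hf ht (w := t⁻¹ • z),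
      smul_smul, mul_inv_cancel₀ ht.ne', one_smul]

/-- `L(K) ⊆ Λ₊`: for `x ∈ L(K)` and `τ > 0`, `e + x/τ ∈ K`, so `x + τe ∈ K` and `p(x + τe) ≠ 0`.
[cite: Guler1997, §3 Theorem 3.2 (proof, second inclusion)] -/
theorem mem_hyperbolicityCone_of_mem_setLinealitySpace (hf : f.IsHomogeneous d) (he : IsHyperbolic f e)
    {x : σ → ℝ} (hx : x ∈ setLinealitySpace (openHyperbolicityCone f e)) : x ∈ hyperbolicityCone f e := by
  intro τ hτ
  have h1 := setLinealitySpace_smul_mem hf hx τ⁻¹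
  rw [mem_setLinealitySpace_iff] at h1
  have h2 : e + τ⁻¹ • x ∈ openHyperbolicityCone f e :=
    (h1 (e + τ⁻¹ • x)).1 (by rw [add_sub_cancel_right]; exact self_mem_openHyperbolicityCone hf he.eval_ne_zero)
  have h3 := smul_mem_openHyperbolicityCone hf h2 hτ
  have h4 : τ • (e + τ⁻¹ • x) = x + τ • e := by
    rw [smul_add, smul_smul, mul_inv_cancel₀ hτ.ne', one_smul, add_comm]
  rw [h4] at h3
  simpa using h3 0 le_rfl

/-- All eigenvalues of a vector of `L(K)` vanish (`x, −x ∈ Λ₊`). [cite: Guler1997, §3 Theorem 3.2 (proof: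
"`s_k(z; x) = 0`")] -/
theorem eigenvalues_eq_zero_of_mem_setLinealitySpace (hf : f.IsHomogeneous d) (he : IsHyperbolic f e)
    {x : σ → ℝ} (hx : x ∈ setLinealitySpace (openHyperbolicityCone f e)) :
    ∀ lam ∈ eigenvalues f e x, lam = 0 := by
  intro lam hlam
  have h1 := (mem_hyperbolicityCone_iff_eigenvalues_nonneg hf he x).1
    (mem_hyperbolicityCone_of_mem_setLinealitySpace hf he hx) lam hlam
  have hnx : -x ∈ setLinealitySpace (openHyperbolicityCone f e) := by
    simpa using setLinealitySpace_smul_mem hf hx (-1)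
  have hmem : -lam ∈ eigenvalues f e (-x) := (mem_eigenvalues_neg_iff hf he x (-lam)).2 (by simpa using hlam)
  have h2 := (mem_hyperbolicityCone_iff_eigenvalues_nonneg hf he (-x)).1
    (mem_hyperbolicityCone_of_mem_setLinealitySpace hf he hnx) (-lam) hmem
  linarith

/-- For `x ∈ L(K)`: `p(x + te) = tᵐ p(e)` ("`p(x + sz) = p(z) ∏ (s − s_k(z; x)) = sᵐ p(z)`").
[cite: Guler1997, §3 Theorem 3.2 (proof)] -/
theorem eval_add_smul_of_mem_setLinealitySpace (hf : f.IsHomogeneous d) (he : IsHyperbolic f e)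
    {x : σ → ℝ} (hx : x ∈ setLinealitySpace (openHyperbolicityCone f e)) (t : ℝ) :
    MvPolynomial.eval (x + t • e) f = MvPolynomial.eval e f * t ^ d := by
  rw [eval_add_smul_eq_eval_mul_prod_eigenvalues hf he x t]
  congr 1
  rw [Multiset.map_congr rfl fun lam hlam => show t + lam = t by
      rw [eigenvalues_eq_zero_of_mem_setLinealitySpace hf he hx lam hlam, add_zero],
    Multiset.map_const', Multiset.prod_replicate, card_eigenvalues hf he x]

/-- Every point moved far enough in the direction `e` lies in `K`: `y + se ∈ K` for all `s ≥ s₀(y)`.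
[cite: Renegar2006, §2 ("`x + te ∈ Λ₊₊`")] -/
theorem exists_forall_le_add_smul_mem (hf : f.IsHomogeneous d) (he : IsHyperbolic f e) (y : σ → ℝ) :
    ∃ s₀ : ℝ, ∀ s : ℝ, s₀ ≤ s → y + s • e ∈ openHyperbolicityCone f e := by
  classical
  set R := (linePoly f y e).roots with hR
  refine ⟨1 + (R.map fun r => |r|).sum, fun s hs τ hτ h0 => ?_⟩
  have hne := linePoly_ne_zero hf he.eval_ne_zero y
  have hroot : s + τ ∈ R := by
    rw [hR, Polynomial.mem_roots hne, Polynomial.IsRoot.def, eval_linePoly, add_smul, ← add_assoc]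
    exact h0
  have hle : |s + τ| ≤ (R.map fun r => |r|).sum :=
    Multiset.single_le_sum (fun a ha => by
      obtain ⟨r, -, rfl⟩ := Multiset.mem_map.1 ha
      exact abs_nonneg r) _ (Multiset.mem_map_of_mem _ hroot)
  have := le_abs_self (s + τ)
  linarith

/-- **Theorem 3.2, second inclusion**: `L(K(p; e)) ⊆ L(p)`. [cite: Guler1997, §3 Theorem 3.2] -/
theorem setLinealitySpace_subset_linealitySpace (hf : f.IsHomogeneous d) (he : IsHyperbolic f e) :
    setLinealitySpace (openHyperbolicityCone f e) ⊆ linealitySpace f := by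
  intro x hx y t
  have hv := setLinealitySpace_smul_mem hf hx t
  -- on `K`, translation by `t • x` does not change `p` (Gårding: every `e' ∈ K` is a hyperbolicity direction)
  have hK : ∀ s : ℝ, y + s • e ∈ openHyperbolicityCone f e →
      MvPolynomial.eval (y + s • e + t • x) f = MvPolynomial.eval (y + s • e) f := by
    intro s hs
    have he' := he.of_mem_openHyperbolicityCone hf hs
    have hv' : t • x ∈ setLinealitySpace (openHyperbolicityCone f (y + s • e)) := by
      rwa [openHyperbolicityCone_eq_of_mem hf he hs]
    have := eval_add_smul_of_mem_setLinealitySpace hf he' hv' 1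
    rwa [one_smul, one_pow, mul_one, add_comm] at this
  -- the univariate polynomial `s ↦ p(y + tx + se) − p(y + se)` vanishes for all large `s`, hence identically
  obtain ⟨s₀, hs₀⟩ := exists_forall_le_add_smul_mem hf he y
  have hP : linePoly f (y + t • x) e - linePoly f y e = 0 := by
    apply Polynomial.eq_zero_of_infinite_isRoot
    refine (Set.Ici_infinite s₀).mono fun s hs => ?_
    simp only [Set.mem_setOf_eq, Polynomial.IsRoot.def, Polynomial.eval_sub, eval_linePoly]
    rw [add_right_comm, hK s (hs₀ s hs), sub_self]
  have h0 := congrArg (Polynomial.eval 0) hP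
  simp only [Polynomial.eval_sub, eval_linePoly, zero_smul, add_zero, Polynomial.eval_zero, sub_eq_zero] at h0
  exact h0

/-- **Theorem 3.2** (Güler 1997): `L(p) = L(K(p; e))` for a form `p` hyperbolic with respect to `e`.
[cite: Guler1997, §3 Theorem 3.2] -/
theorem linealitySpace_eq (hf : f.IsHomogeneous d) (he : IsHyperbolic f e) :
    linealitySpace f = setLinealitySpace (openHyperbolicityCone f e) :=
  Set.Subset.antisymm (linealitySpace_subset_setLinealitySpace hf he)
    (setLinealitySpace_subset_linealitySpace hf he)

/-- Definition 3.2 through the cone: `p` is complete iff `L(K(p; e)) = {0}` ("if and only if `K(p; d)` is a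
regular cone"). [cite: Guler1997, §3 Definition 3.2] -/
theorem isCompleteHyperbolic_iff_setLinealitySpace (hf : f.IsHomogeneous d) (he : IsHyperbolic f e) :
    IsCompleteHyperbolic f ↔ setLinealitySpace (openHyperbolicityCone f e) = {0} := by
  rw [IsCompleteHyperbolic, linealitySpace_eq hf he]

end Literature.AlgebraicGeometry.HyperbolicPolynomials
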